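import Mathlib

/-!
# Stub `stub_pairIneq` for the crux `BrascampLiebVacuum` (line `SketchIdeator2`)

The per-pair elementary inequality behind the thermal reflection-positivity square root:
for `q ∈ [0,1]` and a period `L ≥ 1`, with variance weight `v = (1 + q^L)/2`, one-step
weight `γ = 1 + q^L - q - q^{L-1}` and susceptibility weight `β = Σ_{u<L} (q^u + q^{L-u})/2`,
the three sign facts `v, γ, β ≥ 0` hold and `v ≤ 3 √(γ β) + 4 β / L`.

Proof. Write `L = k + 1` and `s = Σ_{u<L} q^u`; then `γ = (1 - q^k)(1 - q)`, `β ≥ s/2` and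
`s (1 - q) = 1 - q^L` (telescoping). If `q^k ≤ 1/2` then `γ β ≥ (1 - q^k)(1 - q^L)/2 ≥ 1/8`,
so `3 √(γ β) ≥ 3/4 ≥ v`; if `q^k > 1/2` then every `q^u`, `u < L`, is `≥ q^k`, so `s ≥ L q^k`
and `4 β / L ≥ 2 q^k > 1 ≥ v`.
-/

open scoped BigOperators

namespace Summit.QuantumFields.YangMills.Theorems.BrascampLiebVacuum

/-- **Stub (elementary, S).** The per-pair inequality behind the thermal reflection-positivity
square root: for `q ∈ [0,1]` and period `L ≥ 1`, with variance weight `v = (1 + q^L)/2`,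
one-step weight `γ = 1 + q^L - q - q^{L-1} = (1 - q^{L-1})(1 - q) ≥ 0` and susceptibility weight
`β = Σ_{u<L} (q^u + q^{L-u})/2 = (1+q)/2 · Σ_{u<L} q^u ≥ 0`: `v ≤ 3 √(γ β) + 4 β / L`
(if `q^{L-1} ≤ 1/2` the square root dominates since `γ β ≥ (1 - q^{L-1})(1 - q^L)/2 ≥ 1/8`;
if `q^{L-1} > 1/2` then `β ≥ L q^{L-1} / 2 > L/4 ≥ L v / 4`). [folklore] -/
theorem stub_pairIneq :
    ∀ (L : ℕ), 1 ≤ L → ∀ q : ℝ, 0 ≤ q → q ≤ 1 →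
      0 ≤ (1 + q ^ L) / 2 ∧
      0 ≤ 1 + q ^ L - q - q ^ (L - 1) ∧
      0 ≤ ∑ u ∈ Finset.range L, (q ^ u + q ^ (L - u)) / 2 ∧
      (1 + q ^ L) / 2 ≤
        3 * Real.sqrt ((1 + q ^ L - q - q ^ (L - 1)) *
              ∑ u ∈ Finset.range L, (q ^ u + q ^ (L - u)) / 2) +
          4 * (∑ u ∈ Finset.range L, (q ^ u + q ^ (L - u)) / 2) / L := by
  intro L hL q hq0 hq1
  obtain ⟨k, rfl⟩ := Nat.exists_eq_add_of_le' hL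
  simp only [Nat.add_sub_cancel]
  -- elementary facts about the powers of `q`
  have hqk : q ^ k ≤ 1 := pow_le_one₀ hq0 hq1
  have hqL : q ^ (k + 1) ≤ 1 := pow_le_one₀ hq0 hq1
  have hqL0 : 0 ≤ q ^ (k + 1) := pow_nonneg hq0 (k + 1)
  have hqLk : q ^ (k + 1) ≤ q ^ k := pow_le_pow_of_le_one hq0 hq1 (Nat.le_succ k)
  -- the one-step weight factors
  have hγ : 1 + q ^ (k + 1) - q - q ^ k = (1 - q ^ k) * (1 - q) := by ring
  have hγ0 : 0 ≤ 1 + q ^ (k + 1) - q - q ^ k := by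
    rw [hγ]; exact mul_nonneg (by linarith) (by linarith)
  -- the geometric sum `s` and the susceptibility weight `β`
  set s := ∑ u ∈ Finset.range (k + 1), q ^ u with hs_def
  set β := ∑ u ∈ Finset.range (k + 1), (q ^ u + q ^ (k + 1 - u)) / 2 with hβ_def
  have hβs : s / 2 ≤ β := by
    rw [hs_def, hβ_def, Finset.sum_div]
    refine Finset.sum_le_sum fun u _ => ?_
    have := pow_nonneg hq0 (k + 1 - u)
    linarith
  have hs0 : 0 ≤ s := Finset.sum_nonneg fun u _ => pow_nonneg hq0 u
  have hβ0 : 0 ≤ β := by linarith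
  have hgeom : s * (1 - q) = 1 - q ^ (k + 1) := geom_sum_mul_neg q (k + 1)
  refine ⟨by linarith, hγ0, hβ0, ?_⟩
  have hLpos : (0 : ℝ) < ((k + 1 : ℕ) : ℝ) := by positivity
  have hsqrt0 : 0 ≤ Real.sqrt ((1 + q ^ (k + 1) - q - q ^ k) * β) := Real.sqrt_nonneg _
  have hdiv0 : 0 ≤ 4 * β / ((k + 1 : ℕ) : ℝ) := by positivity
  rcases le_or_gt (q ^ k) (1 / 2) with hk | hk
  · -- Case `q^k ≤ 1/2`: the square root dominates
    have hprod : 1 / 8 ≤ (1 + q ^ (k + 1) - q - q ^ k) * β := by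
      have h1 : (1 + q ^ (k + 1) - q - q ^ k) * (s / 2) ≤ (1 + q ^ (k + 1) - q - q ^ k) * β :=
        mul_le_mul_of_nonneg_left hβs hγ0
      have h2 : (1 + q ^ (k + 1) - q - q ^ k) * (s / 2) =
          (1 - q ^ k) * (1 - q ^ (k + 1)) / 2 := by
        rw [hγ, ← hgeom]; ring
      have h3 : 1 / 8 ≤ (1 - q ^ k) * (1 - q ^ (k + 1)) / 2 := by nlinarith
      linarith
    have hsq : 1 / 4 ≤ Real.sqrt ((1 + q ^ (k + 1) - q - q ^ k) * β) :=
      Real.le_sqrt_of_sq_le (by nlinarith)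
    linarith
  · -- Case `q^k > 1/2`: the mean (zero-mode) term dominates
    have hsk : ((k + 1 : ℕ) : ℝ) * q ^ k ≤ s := by
      have h : ∑ _u ∈ Finset.range (k + 1), q ^ k ≤ s :=
        Finset.sum_le_sum fun u hu =>
          pow_le_pow_of_le_one hq0 hq1 (Nat.lt_succ_iff.mp (Finset.mem_range.mp hu))
      simpa [Finset.sum_const, Finset.card_range, nsmul_eq_mul] using h
    have hdiv : 2 * q ^ k ≤ 4 * β / ((k + 1 : ℕ) : ℝ) := by
      rw [le_div_iff₀ hLpos]
      nlinarith
    linarith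

end Summit.QuantumFields.YangMills.Theorems.BrascampLiebVacuum
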